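import Summits.ResolutionOfSingularities.ResolutionOfSingularities.Theorems.WeightedInvariantAQSBaseChangeTheorem
import Literature.AlgebraicGeometry.Resolution.FormallySmoothFieldBaseChangeStalks
import HarnessLib

/-!
# Abramovich–Quek–Schober's separable base change: the named fact `AbramovichQuekSchober2025_separableBaseChange` HOLDS

Route `ResolutionOfSingularities/WeightedInvariant`, door crux `HypersurfaceCentreConstruction`
(stmt-ResolutionOfSingularities-19897) — OURS, helper (counted 0); e-ladder `e = 1`, the RESIDUAL of piece
**(o25-δ)** «separable base change of the Abramovich–Quek–Schober centre in the kernel» recorded by its owner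
res-D-pv-025 (DONE 2026-08-27T12:42:39Z: «literal `AbramovichQuekSchober2025_separableBaseChange_holds` for ALL
formally smooth `k′` ⇐ Matsumura Thm 28.7 (dim-0 fibre case), not in the tree») and by res-type-047 (SCOPE NOTE
10:27:19Z: «the general `_holds` then waits only on a Literature «28.7/MacLane» brick»).

`AbramovichQuekSchober2025_separableBaseChange_holds : AbramovichQuekSchober2025_separableBaseChange` — the
DISCHARGE of the Literature named fact (`Literature/AlgebraicGeometry/Resolution/HypersurfaceHeightTwoWeightedCentre.lean`,
Abramovich–Quek–Schober, arXiv:2507.01232, Thm 1.3 (1) / Thm 3.5, last clause: "Moreover, `J` is stable under base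
change to separable field extensions of `k`"), for EVERY formally smooth `k′/k` as typed (no finiteness hypothesis
on `k′/k`).  The proof is res-D-pv-025's `AQSBaseChange.separableBaseChange_of_essFiniteType` (p529007) verbatim,
with res-type-047's (δ2) `separableBaseChange_localData` (p526461, `[Algebra.EssFiniteType k k']`) replaced by the
Literature lemma `Literature.AlgebraicGeometry.Resolution.formallySmoothBaseChange_localData`
(`FormallySmoothFieldBaseChangeStalks.lean`), whose fibre-is-a-field step is Matsumura, *Commutative Ring Theory*,
§28 Lemma 1 / Thm 28.7 in dimension `0` — an Artinian local ring formally smooth over a field is a field — now a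
PROVED Literature theorem (`Literature.RingTheory.Smooth.isField_of_isArtinianRing_of_formallySmooth`,
`ArtinianFormallySmoothField.lean`, p534099).  Inputs consumed by name: (δ-field)
`AQSBaseChange.mem_range_algebraMap_of_pow_mem` (p522038) and the LOCAL THEOREM (δ1c)
`AQSBaseChange.isLexMaxWeightedCentreGerm_map` (p528382), both res-D-pv-025.

Def-free; 0 named facts; net debt −1 (F-55 (b) of the cell's FACT-LIST).  A kernel theorem about weighted-centre
germs of hypersurfaces at height-two points under base change along formally smooth field extensions; nothing here
is a claim about H. Hironaka's manuscript or about resolution in positive characteristic.  AI-written; weaker than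
expert review.  [cite: AbramovichQuekSchober2025, Thm 1.3 (1) / Thm 3.5 (arXiv:2507.01232v1 p. 2 L52–L53, p. 7 L18–L19,
proof p. 7 L94 – p. 8 L40; v3 p. 3 L16–L20, p. 7 L67–L74, p. 8 L75 – p. 9 L7); Matsumura1987, §28 Lemma 1 (p. 216), Thm. 28.7 (p. 219)]
-/

noncomputable section

set_option linter.dupNamespace false -- mandated namespace of this single-conjunct summit

namespace Summit.ResolutionOfSingularities.ResolutionOfSingularities.Theorems.AQSBaseChange

open CategoryTheory AlgebraicGeometry IsLocalRing Literature.AlgebraicGeometry.Resolution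

/-- **Abramovich–Quek–Schober, Thm 1.3 (1) «`J` is stable under base change to separable field extensions of
`k`», for every formally smooth `k′/k`.**  The statement of `AbramovichQuekSchober2025_separableBaseChange` with all
its binders explicit (res-D-pv-025's `separableBaseChange_of_essFiniteType` without `[Algebra.EssFiniteType k k']`).
[cite: AbramovichQuekSchober2025, Thm 1.3 (1), Thm 3.5 (proof p. 7 L94 – p. 8 L40); Matsumura1987, §28 Lemma 1] -/
theorem separableBaseChange (k : Type) [Field k] (Y : Scheme.{0}) (f : Y ⟶ Spec (.of k))
    [LocallyOfFiniteType f] (X : Y.IdealSheafData)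
    (k' : Type) [Field k'] [Algebra k k'] [Algebra.FormallySmooth k k']
    (Y' : Scheme.{0}) (f' : Y' ⟶ Spec (.of k')) (g : Y' ⟶ Y)
    (hsq : IsPullback g f' f (Spec.map (CommRingCat.ofHom (algebraMap k k'))))
    (η' : Y') (hdim' : ringKrullDim (Y'.presheaf.stalk η') = ((2 : ℕ) : WithBot ℕ∞))
    (hreg : IsRegularLocalRing (Y.presheaf.stalk (g.base η')))
    (hdim : ringKrullDim (Y.presheaf.stalk (g.base η')) = ((2 : ℕ) : WithBot ℕ∞))
    (hprinc : (stalkIdeal X (g.base η')).IsPrincipal)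
    (x : Fin 2 → Y.presheaf.stalk (g.base η')) (w : Fin 2 → ℕ) (ℓ : ℕ)
    (hx : IsLexMaxWeightedCentreGerm (Y.presheaf.stalk (g.base η')) (stalkIdeal X (g.base η')) x w ℓ) :
    IsLexMaxWeightedCentreGerm (Y'.presheaf.stalk η') (stalkIdeal (X.comap g) η')
      (fun i => (g.stalkMap η').hom (x i)) w ℓ := by
  obtain ⟨h𝔪, hreg', hflat, hfs, -⟩ := formallySmoothBaseChange_localData f k' hsq η' hreg hdim hdim'
  letI := (g.stalkMap η').hom.toAlgebra
  haveI : IsLocalHom (algebraMap (Y.presheaf.stalk (g.base η')) (Y'.presheaf.stalk η')) :=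
    inferInstanceAs (IsLocalHom (g.stalkMap η').hom)
  haveI : Module.Flat (Y.presheaf.stalk (g.base η')) (Y'.presheaf.stalk η') := hflat
  haveI : Module.FaithfullyFlat (Y.presheaf.stalk (g.base η')) (Y'.presheaf.stalk η') :=
    Module.FaithfullyFlat.of_flat_of_isLocalHom
  haveI := hreg
  haveI := hreg'
  -- the residue field extension is relatively `p`-radically closed
  letI algκ := (IsLocalRing.ResidueField.map (g.stalkMap η').hom).toAlgebra
  haveI : Algebra.FormallySmooth (ResidueField (Y.presheaf.stalk (g.base η')))
      (ResidueField (Y'.presheaf.stalk η')) := hfs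
  obtain ⟨p, hp⟩ := ExpChar.exists (ResidueField (Y.presheaf.stalk (g.base η')))
  haveI : ExpChar (ResidueField (Y'.presheaf.stalk η')) p :=
    expChar_of_injective_algebraMap
      (algebraMap (ResidueField (Y.presheaf.stalk (g.base η'))) (ResidueField (Y'.presheaf.stalk η'))).injective p
  have hcl : ∀ z : ResidueField (Y'.presheaf.stalk η'),
      z ^ p ∈ (ResidueField.map (algebraMap (Y.presheaf.stalk (g.base η')) (Y'.presheaf.stalk η'))).range →
        z ∈ (ResidueField.map (algebraMap (Y.presheaf.stalk (g.base η')) (Y'.presheaf.stalk η'))).range :=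
    fun z hz => mem_range_algebraMap_of_pow_mem p hz
  -- the principal ideal and the local theorem
  haveI := hprinc
  have hgen := Ideal.span_singleton_generator (stalkIdeal X (g.base η'))
  rw [← hgen] at hx
  have key := isLexMaxWeightedCentreGerm_map hdim hdim' h𝔪 p hcl hx
  rw [stalkIdeal_comap_eq_map_stalkMap, ← hgen, Ideal.map_span, Set.image_singleton]
  exact key

/-- **DISCHARGE of the named fact `AbramovichQuekSchober2025_separableBaseChange`** (Abramovich–Quek–Schober 2025,
Thm 1.3 (1) / Thm 3.5, last clause: "Moreover, `J` is stable under base change to separable field extensions of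
`k`", as typed in `Literature/AlgebraicGeometry/Resolution/HypersurfaceHeightTwoWeightedCentre.lean`): the statement
holds literally, for every formally smooth `k′/k`.  Users of `(h : AbramovichQuekSchober2025_separableBaseChange)` are fed
this theorem. [cite: AbramovichQuekSchober2025, Thm 1.3 (1) / Thm 3.5; Matsumura1987, §28 Lemma 1 (p. 216)] -/
theorem AbramovichQuekSchober2025_separableBaseChange_holds : AbramovichQuekSchober2025_separableBaseChange := by
  intro k _ Y f _ X k' _ _ _ Y' f' g hsq η' hdim' hreg hdim hprinc _ _ x w ℓ hx
  exact separableBaseChange k Y f X k' Y' f' g hsq η' hdim' hreg hdim hprinc x w ℓ hx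

end Summit.ResolutionOfSingularities.ResolutionOfSingularities.Theorems.AQSBaseChange

end
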